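import Literature.NumberTheory.LFunctions.FourthMomentDirichletPrimeModulus
import Mathlib.Analysis.SpecialFunctions.Pow.Real
import Mathlib.Analysis.Complex.ExponentialBounds
import HarnessLib

/-!
# The fourth moment to one prime modulus: Young 2011 Theorem 1.1 FROM Blomer–Fouvry–Kowalski–
# Michel–Milićević 2017 Theorem 1.5 — PROOF file (sibling of the statement file)

Proof-only companion of `FourthMomentDirichletPrimeModulus.lean` (cell `landau-siegel` §C, rows
r8-T21/T27; T-137 append): theorems only, no definitions, no named facts (D-0014/D-0026, kernel lane).
It records the bookkeeping by which the later record implies the earlier one AS TYPED: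

* [BlomerFouvryKowalskiMichelMilicevic2017Steklov, Thm 1.5] (`bfkmm2017_theorem15`): for prime `q`,
  `(1/(q−1)) Σ_{χ mod q} |L(χ,½)|⁴ = P₄(log q) + O_ε(q^{−1/20+ε})` — ALL `q − 1` characters, the trivial
  one included (`allFourthMoment`);
* [Young2011, Thm 1.1] (`young2011_theorem11`): for prime `q ≠ 2`,
  `(1/φ*(q)) Σ*_{χ mod q} |L(½,χ)|⁴ = Σ_{i≤4} c_i (log q)^i + O_ε(q^{−5/512+ε})` — the `φ*(q) = q − 2`
  PRIMITIVE characters (`primitiveFourthMoment`, `primitiveCount`).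

`young2011_theorem11_of_bfkmm2017_theorem15 : bfkmm2017_theorem15 → young2011_theorem11`, with
`c_i` = the coefficients of `P₄`. The two normalisations differ by the trivial character only: for a
prime modulus every character `≠ χ₀` is primitive (`isPrimitive_iff_ne_one`, conductor `∣ q`), there are
`q − 1` characters (`DirichletCharacter.card_eq_totient_of_hasEnoughRootsOfUnity`) hence `φ*(q) = q − 2`
(`primitiveCount_eq`), and `L(½, χ₀) = (1 − q^{−1/2}) ζ(½)` (Mathlib
`DirichletCharacter.LFunctionTrivChar_eq_mul_riemannZeta`) is bounded; so
`|M* − M_all| ≤ (2 M_all + |L(½,χ₀)|⁴)/(q − 1) ≪_ε q^{−1+ε}` (`log⁴ q ≤ (4/ε)⁴ q^ε`), and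
`q^{−1/20+ε}, q^{−1+ε} ≤ q^{−5/512+ε}`. (BFKMM's saving `1/20` exceeds Young's `5/512`; this module checks
that the two typed facts are compatible in that direction — it does not touch either source's proof.)
[cite: Young2011, Thm 1.1] [cite: BlomerFouvryKowalskiMichelMilicevic2017Steklov, Thm 1.5]

«The programme SEARCHES and TYPES; no claim about Landau–Siegel zeros, Theorems 1–2 of
arXiv:2211.02515 or a repaired Margin232 until a kernel theorem says so.»
-/

noncomputable section

open Finset DirichletCharacter
open scoped Classical

namespace Literature.NumberTheory.LFunctions

namespace FourthMomentPrimeModulus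

variable {q : ℕ} [NeZero q]

/-- For a prime modulus, a character is primitive iff it is non-trivial (its conductor divides the
prime `q`). [cite: Young2011, Thm 1.1 (φ*(q) = q − 2 for prime q)] -/
theorem isPrimitive_iff_ne_one (hq : q.Prime) (χ : DirichletCharacter ℂ q) :
    χ.IsPrimitive ↔ χ ≠ 1 := by
  rw [isPrimitive_def]
  constructor
  · intro h h1
    rw [eq_one_iff_conductor_eq_one] at h1
    rw [h1] at h
    exact hq.one_lt.ne h
  · intro h1
    rcases hq.eq_one_or_self_of_dvd _ χ.conductor_dvd_level with h | h
    · exact absurd (eq_one_iff_conductor_eq_one.mpr h) h1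
    · exact h

/-- For a prime modulus the primitive characters are all characters but the trivial one. [folklore] -/
private theorem filter_isPrimitive_eq (hq : q.Prime) :
    (univ.filter fun χ : DirichletCharacter ℂ q ↦ χ.IsPrimitive) = univ.erase 1 := by
  ext χ
  simp [mem_filter, mem_erase, isPrimitive_iff_ne_one hq]

/-- There are `q − 1` Dirichlet characters mod a prime `q` (values in `ℂ`). [folklore] -/
private theorem card_univ_eq (hq : q.Prime) :
    (univ : Finset (DirichletCharacter ℂ q)).card = q - 1 := by
  rw [Finset.card_univ, ← Nat.card_eq_fintype_card, card_eq_totient_of_hasEnoughRootsOfUnity ℂ q,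
    Nat.totient_prime hq]

/-- **`φ*(q) = q − 2` for prime `q`.** [cite: Young2011, Thm 1.1 (the normalisation 1/φ*(q))] -/
theorem primitiveCount_eq (hq : q.Prime) : primitiveCount q = q - 2 := by
  unfold primitiveCount
  rw [filter_isPrimitive_eq hq, card_erase_of_mem (mem_univ _), card_univ_eq hq]
  omega

/-- The primitive fourth-moment SUM is the full sum minus the trivial character's term (prime `q`).
[cite: BlomerFouvryKowalskiMichelMilicevic2017Steklov, Thm 1.5 (all q − 1 characters)] -/
theorem sum_primitive_eq (hq : q.Prime) :
    (∑ χ : DirichletCharacter ℂ q with χ.IsPrimitive, ‖χ.LFunction (1 / 2)‖ ^ 4) =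
      (∑ χ : DirichletCharacter ℂ q, ‖χ.LFunction (1 / 2)‖ ^ 4) -
        ‖(1 : DirichletCharacter ℂ q).LFunction (1 / 2)‖ ^ 4 := by
  rw [filter_isPrimitive_eq hq, Finset.sum_erase_eq_sub (mem_univ _)]

/-- **The trivial character's term is bounded**: for prime `q`,
`|L(½, χ₀)| = |1 − q^{−1/2}|·|ζ(½)| ≤ 2 |ζ(½)|`. [cite: BlomerFouvryKowalskiMichelMilicevic2017Steklov,
Thm 1.5 (the trivial character is included)] -/
theorem norm_LFunction_one_half_le (hq : q.Prime) :
    ‖(1 : DirichletCharacter ℂ q).LFunction (1 / 2)‖ ≤ 2 * ‖riemannZeta (1 / 2)‖ := by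
  have hs : (1 / 2 : ℂ) ≠ 1 := by norm_num
  have h := LFunctionTrivChar_eq_mul_riemannZeta (N := q) hs
  rw [LFunctionTrivChar] at h
  rw [h, hq.primeFactors, prod_singleton, norm_mul]
  refine mul_le_mul_of_nonneg_right ?_ (norm_nonneg _)
  have hq0 : 0 < q := hq.pos
  calc ‖(1 : ℂ) - (q : ℂ) ^ (-(1 / 2 : ℂ))‖ ≤ ‖(1 : ℂ)‖ + ‖(q : ℂ) ^ (-(1 / 2 : ℂ))‖ := norm_sub_le _ _
    _ ≤ 1 + 1 := by
        rw [norm_one, Complex.norm_natCast_cpow_of_pos hq0]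
        have hre : (-(1 / 2 : ℂ)).re = -(1 / 2) := by norm_num
        rw [hre]
        have h1 : (q : ℝ) ^ (-(1 / 2) : ℝ) ≤ 1 :=
          Real.rpow_le_one_of_one_le_of_nonpos (by exact_mod_cast hq.one_lt.le) (by norm_num)
        linarith
    _ = 2 := by norm_num

/-- `log⁴ q ≤ (4/ε)⁴ q^ε` for `q ≥ 1` (from `log x ≤ x^δ/δ`, `δ = ε/4`). [folklore] -/
private theorem log_pow_four_le {x ε : ℝ} (hx : 1 ≤ x) (hε : 0 < ε) :
    Real.log x ^ 4 ≤ (4 / ε) ^ 4 * x ^ ε := by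
  have h0 : 0 ≤ Real.log x := Real.log_nonneg hx
  have h1 : Real.log x ≤ x ^ (ε / 4) / (ε / 4) := Real.log_le_rpow_div (by linarith) (by linarith)
  have h2 : x ^ (ε / 4) / (ε / 4) = 4 / ε * x ^ (ε / 4) := by field_simp
  rw [h2] at h1
  have h3 : Real.log x ^ 4 ≤ (4 / ε * x ^ (ε / 4)) ^ 4 := pow_le_pow_left₀ h0 h1 4
  have h4 : (x ^ (ε / 4)) ^ 4 = x ^ ε := by
    rw [← Real.rpow_natCast, ← Real.rpow_mul (by linarith)]
    norm_num
  calc Real.log x ^ 4 ≤ (4 / ε * x ^ (ε / 4)) ^ 4 := h3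
    _ = (4 / ε) ^ 4 * x ^ ε := by rw [mul_pow, h4]

end FourthMomentPrimeModulus

open FourthMomentPrimeModulus

/-- **Young 2011, Theorem 1.1 from BFKMM 2017, Theorem 1.5 (as typed).** With `c_i` the coefficients of
BFKMM's `P₄`: for every `ε > 0` there is `C'` such that for all primes `q ≠ 2`,
`|(1/φ*(q)) Σ*_χ |L(½,χ)|⁴ − Σ_{i≤4} c_i (log q)^i| ≤ C' q^{−5/512+ε}` — because the two averages differ
only by the (bounded) trivial-character term and the normalisations `q − 1` vs `q − 2`, an error
`≪_ε q^{−1+ε}`, and `q^{−1/20+ε} ≤ q^{−5/512+ε}`. [cite: Young2011, Thm 1.1]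
[cite: BlomerFouvryKowalskiMichelMilicevic2017Steklov, Thm 1.5] -/
theorem young2011_theorem11_of_bfkmm2017_theorem15 (h : bfkmm2017_theorem15) :
    young2011_theorem11 := by
  obtain ⟨P, hdeg, hP⟩ := h
  refine ⟨fun i ↦ P.coeff i, fun ε hε ↦ ?_⟩
  obtain ⟨C, hC⟩ := hP ε hε
  -- constants
  set C₀ : ℝ := max C 0 with hC₀
  set A : ℝ := ∑ i : Fin 5, |P.coeff i| with hA
  set T₀ : ℝ := (2 * ‖riemannZeta (1 / 2)‖) ^ 4 with hT₀
  set K₁ : ℝ := 4 * (A * (4 / ε) ^ 4) + 4 * C₀ + 2 * T₀ with hK₁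
  have hC₀0 : 0 ≤ C₀ := le_max_right _ _
  have hA0 : 0 ≤ A := Finset.sum_nonneg fun i _ ↦ abs_nonneg _
  have hT₀0 : 0 ≤ T₀ := by positivity
  have hK₁0 : 0 ≤ K₁ := by positivity
  refine ⟨C₀ + K₁, fun q _ hq hq2 ↦ ?_⟩
  -- the modulus
  have hq3 : 3 ≤ q := by
    have := hq.two_le
    omega
  have hqR : (3 : ℝ) ≤ q := by exact_mod_cast hq3
  have hq1 : (1 : ℝ) ≤ q := by linarith
  have hq0 : (0 : ℝ) < q := by linarith
  have hlog1 : 1 ≤ Real.log (q : ℝ) := by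
    rw [← Real.log_exp 1]
    refine Real.log_le_log (Real.exp_pos 1) ?_
    have := Real.exp_one_lt_d9
    linarith
  have hlog0 : 0 ≤ Real.log (q : ℝ) := by linarith
  -- `P(log q) = Σ_{i<5} c_i (log q)^i`, and `|P(log q)| ≤ A log⁴ q`
  have heval : P.eval (Real.log q) = ∑ i : Fin 5, P.coeff i * Real.log q ^ (i : ℕ) := by
    rw [Polynomial.eval_eq_sum_range' (n := 5) (by omega), Finset.sum_range]
  have hPle : |P.eval (Real.log q)| ≤ A * Real.log q ^ 4 := by
    rw [heval, hA, Finset.sum_mul]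
    refine (Finset.abs_sum_le_sum_abs _ _).trans (Finset.sum_le_sum fun i _ ↦ ?_)
    rw [abs_mul, abs_of_nonneg (pow_nonneg hlog0 _)]
    refine mul_le_mul_of_nonneg_left ?_ (abs_nonneg _)
    exact pow_le_pow_right₀ hlog1 (by omega)
  -- BFKMM at `q`
  have hall : |allFourthMoment q - P.eval (Real.log q)| ≤ C₀ * (q : ℝ) ^ (-(1 : ℝ) / 20 + ε) :=
    (hC q hq).trans (mul_le_mul_of_nonneg_right (le_max_left _ _) (Real.rpow_nonneg hq0.le _))
  -- the sums
  set S : ℝ := ∑ χ : DirichletCharacter ℂ q, ‖χ.LFunction (1 / 2)‖ ^ 4 with hS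
  set t : ℝ := ‖(1 : DirichletCharacter ℂ q).LFunction (1 / 2)‖ ^ 4 with ht
  have hS0 : 0 ≤ S := Finset.sum_nonneg fun χ _ ↦ by positivity
  have ht0 : 0 ≤ t := by positivity
  have htS : t ≤ S := by
    rw [hS, ht]
    exact Finset.single_le_sum (f := fun χ : DirichletCharacter ℂ q ↦ ‖χ.LFunction (1 / 2)‖ ^ 4)
      (fun χ _ ↦ by positivity) (mem_univ 1)
  have htT : t ≤ T₀ := by
    rw [ht, hT₀]
    exact pow_le_pow_left₀ (norm_nonneg _) (norm_LFunction_one_half_le hq) 4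
  have hallS : allFourthMoment q = S / ((q : ℝ) - 1) := rfl
  have hprimS : primitiveFourthMoment q = (S - t) / ((q : ℝ) - 2) := by
    unfold primitiveFourthMoment
    rw [sum_primitive_eq hq, primitiveCount_eq hq]
    congr 1
    rw [Nat.cast_sub (by omega)]
    norm_num
  -- `all ≥ 0` and the BFKMM size of `all`
  have hall0 : 0 ≤ allFourthMoment q := by rw [hallS]; exact div_nonneg hS0 (by linarith)
  have hrpow1 : (q : ℝ) ^ (-(1 : ℝ) / 20 + ε) ≤ (q : ℝ) ^ ε :=
    Real.rpow_le_rpow_of_exponent_le hq1 (by linarith)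
  have hqε1 : 1 ≤ (q : ℝ) ^ ε := Real.one_le_rpow hq1 hε.le
  have hallBound : allFourthMoment q ≤ A * (4 / ε) ^ 4 * (q : ℝ) ^ ε + C₀ * (q : ℝ) ^ ε := by
    have h1 : allFourthMoment q ≤ |P.eval (Real.log q)| + C₀ * (q : ℝ) ^ (-(1 : ℝ) / 20 + ε) := by
      have := abs_sub_le_iff.mp hall
      have := le_abs_self (P.eval (Real.log q))
      linarith [this]
    have h2 : |P.eval (Real.log q)| ≤ A * (4 / ε) ^ 4 * (q : ℝ) ^ ε := by
      refine hPle.trans ?_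
      rw [mul_assoc]
      exact mul_le_mul_of_nonneg_left (log_pow_four_le hq1 hε) hA0
    have h3 : C₀ * (q : ℝ) ^ (-(1 : ℝ) / 20 + ε) ≤ C₀ * (q : ℝ) ^ ε :=
      mul_le_mul_of_nonneg_left hrpow1 hC₀0
    linarith
  -- `|prim − all| ≤ (2 all + t)/(q − 1) ≤ K₁ q^ε / q`
  have hq1' : (0 : ℝ) < (q : ℝ) - 1 := by linarith
  have hq2' : (0 : ℝ) < (q : ℝ) - 2 := by linarith
  have hdiff : |primitiveFourthMoment q - allFourthMoment q| ≤
      (2 * allFourthMoment q + t) / ((q : ℝ) - 1) := by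
    rw [hprimS, hallS]
    -- `(S − t)/(q−2) − S/(q−1) = (S − t)/((q−1)(q−2)) − t/(q−1)`
    have hid : (S - t) / ((q : ℝ) - 2) - S / ((q : ℝ) - 1) =
        (S - t) / (((q : ℝ) - 1) * ((q : ℝ) - 2)) - t / ((q : ℝ) - 1) := by
      field_simp
      ring
    rw [hid]
    have hSt : 0 ≤ S - t := by linarith
    have hA' : 0 ≤ (S - t) / (((q : ℝ) - 1) * ((q : ℝ) - 2)) := div_nonneg hSt (by positivity)
    have hB' : 0 ≤ t / ((q : ℝ) - 1) := div_nonneg ht0 hq1'.le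
    have habs : |(S - t) / (((q : ℝ) - 1) * ((q : ℝ) - 2)) - t / ((q : ℝ) - 1)| ≤
        (S - t) / (((q : ℝ) - 1) * ((q : ℝ) - 2)) + t / ((q : ℝ) - 1) := by
      rw [abs_le]; constructor <;> linarith
    refine habs.trans ?_
    -- `(S − t)/((q−1)(q−2)) = prim/(q−1)` and `prim = (S−t)/(q−2) ≤ S/(q−2) ≤ 2 S/(q−1) = 2 all`
    have hprim_le : (S - t) / ((q : ℝ) - 2) ≤ 2 * (S / ((q : ℝ) - 1)) := by
      rw [div_le_iff₀ hq2']
      have : 2 * (S / ((q : ℝ) - 1)) * ((q : ℝ) - 2) = S * (2 * ((q : ℝ) - 2) / ((q : ℝ) - 1)) := by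
        ring
      rw [this]
      have hfrac : 1 ≤ 2 * ((q : ℝ) - 2) / ((q : ℝ) - 1) := by
        rw [le_div_iff₀ hq1']; linarith
      nlinarith
    have hkey : (S - t) / (((q : ℝ) - 1) * ((q : ℝ) - 2)) = (S - t) / ((q : ℝ) - 2) / ((q : ℝ) - 1) := by
      rw [div_div, mul_comm]
    rw [hkey, ← add_div, div_le_div_iff_of_pos_right hq1']
    linarith
  have hdiff2 : |primitiveFourthMoment q - allFourthMoment q| ≤ K₁ * (q : ℝ) ^ ε / q := by
    refine hdiff.trans ?_
    -- numerator ≤ K₁ q^ε / 2 and `q − 1 ≥ q/2`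
    have hnum : 2 * allFourthMoment q + t ≤ K₁ * (q : ℝ) ^ ε / 2 := by
      rw [hK₁]
      have : t ≤ T₀ * (q : ℝ) ^ ε := htT.trans (le_mul_of_one_le_right hT₀0 hqε1)
      nlinarith [hallBound, this, Real.rpow_nonneg hq0.le ε]
    have hden : (q : ℝ) / 2 ≤ (q : ℝ) - 1 := by linarith
    calc (2 * allFourthMoment q + t) / ((q : ℝ) - 1)
        ≤ (K₁ * (q : ℝ) ^ ε / 2) / ((q : ℝ) - 1) := div_le_div_of_nonneg_right hnum hq1'.le
      _ ≤ (K₁ * (q : ℝ) ^ ε / 2) / ((q : ℝ) / 2) :=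
          div_le_div_of_nonneg_left
            (div_nonneg (mul_nonneg hK₁0 (Real.rpow_nonneg hq0.le ε)) (by norm_num))
            (div_pos hq0 two_pos) hden
      _ = K₁ * (q : ℝ) ^ ε / q := by field_simp
  -- exponents: `q^ε/q = q^{ε−1} ≤ q^{−5/512+ε}` and `q^{−1/20+ε} ≤ q^{−5/512+ε}`
  have hE1 : (q : ℝ) ^ ε / q ≤ (q : ℝ) ^ (-(5 : ℝ) / 512 + ε) := by
    rw [div_eq_mul_inv, ← Real.rpow_neg_one, ← Real.rpow_add hq0]
    exact Real.rpow_le_rpow_of_exponent_le hq1 (by linarith)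
  have hE2 : (q : ℝ) ^ (-(1 : ℝ) / 20 + ε) ≤ (q : ℝ) ^ (-(5 : ℝ) / 512 + ε) :=
    Real.rpow_le_rpow_of_exponent_le hq1 (by linarith)
  -- assemble
  rw [← heval]
  have htri : |primitiveFourthMoment q - P.eval (Real.log q)| ≤
      |primitiveFourthMoment q - allFourthMoment q| + |allFourthMoment q - P.eval (Real.log q)| := by
    have := abs_sub_le (primitiveFourthMoment q) (allFourthMoment q) (P.eval (Real.log q))
    exact this
  calc |primitiveFourthMoment q - P.eval (Real.log q)|
      ≤ K₁ * (q : ℝ) ^ ε / q + C₀ * (q : ℝ) ^ (-(1 : ℝ) / 20 + ε) := by linarith [hdiff2, hall]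
    _ ≤ K₁ * (q : ℝ) ^ (-(5 : ℝ) / 512 + ε) + C₀ * (q : ℝ) ^ (-(5 : ℝ) / 512 + ε) := by
        have h1 : K₁ * (q : ℝ) ^ ε / q ≤ K₁ * (q : ℝ) ^ (-(5 : ℝ) / 512 + ε) := by
          rw [mul_div_assoc]; exact mul_le_mul_of_nonneg_left hE1 hK₁0
        have h2 := mul_le_mul_of_nonneg_left hE2 hC₀0
        linarith
    _ = (C₀ + K₁) * (q : ℝ) ^ (-(5 : ℝ) / 512 + ε) := by ring

end Literature.NumberTheory.LFunctions
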